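import Summits.CriticalPhenomena.Ising3DConformalLimit.Theorems.EnergyNotSigmaSquaredMoebiusLimitExistsPedigreeCoveringGames
import HarnessLib

/-!
# Mirror pedigrees II: the covering theorem (stub covering_all of line only-interaction-breaks-moebius, crux MoebiusLimitExists, item stmt-CriticalPhenomena-1344, route EnergyNotSigmaSquared)

The COVERING THEOREM of the MIRROR-PEDIGREE toolkit (`Cover.covering_cv`, `covering_all`): every
finite configuration `P ⊂ ℝ³` (moving point translated to `0`) admits finitely many admissible cuts
in the 18 signed cubic mirror directions after which `0` is the strict extreme point in a coordinate
direction (`HasPedigree P` of `Theorems/MoebiusLimitExists/Negative/PedigreeCuts.lean`, namespace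
`…MoebiusLimitExistsNegative.Pedigree.Cover`, whose `Pt`, `pdot`, `prefl`, `pcut`, `dirs`,
`HasPedigree`, `IsBlocker`, … are the ones used here).

Assembly: step (i) (`Cover.noAxis_after_diag_cv`: one cut `(−e₁+e₂, t₀)` kills the AXIS blockers),
game (Z) (`Cover.gameZ_cv`: `±e₃` cuts kill the blockers of the plane `p₂ = 0`, by induction on the
measure `⌊A/c₊⌋₊ + ⌊A/c₋⌋₊`), then game (M) and PHASE 2 (`hasPedigree_of_noPlaneBlocker_cv` of the
companion file `EnergyNotSigmaSquaredMoebiusLimitExistsPedigreeCoveringGames.lean`). Nothing here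
asserts a Theses statement; every fact is elementary real arithmetic on finite configurations of `ℝ³`.
-/

noncomputable section

namespace Summit.CriticalPhenomena.Ising3DConformalLimit.MoebiusLimitExistsOnlyInteraction

open Classical
open Summit.CriticalPhenomena.Ising3DConformalLimit.MoebiusLimitExistsNegative.Pedigree.Cover

namespace Cover

-- ported from Cruxes/MoebiusLimitExists/Disproof.lean §G.3 (refuter-cdisprove gen 4), kernel-checked there

/-! ### PHASE 1, game (Z): killing the blockers of the plane `p₂ = 0` with `±e₃` cuts -/

/-- (F1) for the cut `(e₃, T)`: image `(p₁, p₂, 2T − p₃)` of a kept point (`p₃ < T`). [folklore] -/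
theorem blocker_of_image_e3_cv {p : Pt} {T : ℝ} (hT : 0 < T) (hk : p.2.2 < T)
    (hb : IsBlocker (p.1, p.2.1, 2 * T - p.2.2)) : IsBlocker p := by
  obtain ⟨-, h2, h3⟩ := hb
  simp only at h2 h3
  have habs : |p.2.2| < |2 * T - p.2.2| := by
    rw [abs_of_pos (by linarith : 0 < 2 * T - p.2.2)]
    rcases le_or_gt 0 p.2.2 with h | h
    · rw [abs_of_nonneg h]; linarith
    · rw [abs_of_neg h]; linarith
  have h1 : p.1 < -|p.2.2| := by linarith
  refine ⟨?_, h2, h1.le⟩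
  intro h0; rw [h0] at h1; simp at h1

/-- (F1) for the cut `(−e₃, T)`: image `(p₁, p₂, −2T − p₃)` of a kept point (`−p₃ < T`). [folklore] -/
theorem blocker_of_image_me3_cv {p : Pt} {T : ℝ} (hT : 0 < T) (hk : -p.2.2 < T)
    (hb : IsBlocker (p.1, p.2.1, -2 * T - p.2.2)) : IsBlocker p := by
  obtain ⟨-, h2, h3⟩ := hb
  simp only at h2 h3
  have habs : |p.2.2| < |-2 * T - p.2.2| := by
    rw [abs_of_neg (by linarith : -2 * T - p.2.2 < 0)]
    rcases le_or_gt 0 p.2.2 with h | h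
    · rw [abs_of_nonneg h]; linarith
    · rw [abs_of_neg h]; linarith
  have h1 : p.1 < -|p.2.2| := by linarith
  refine ⟨?_, h2, h1.le⟩
  intro h0; rw [h0] at h1; simp at h1

/-- A blocker has `|p₃| ≤ −p₁`. [folklore] -/
theorem abs3_le_of_isBlocker_cv {p : Pt} (hb : IsBlocker p) : |p.2.2| ≤ -p.1 := by linarith [hb.2.2]

/-- **Game (Z)**: with a level bound `A` and no AXIS blocker (`p₂ = p₃ = 0`), the configuration has
a pedigree provided every configuration with the level bound and no blocker on the plane `p₂ = 0`
has one (game (M)). Same induction, in the coordinate `p₃`, on the blockers with `p₂ = 0`. [folklore] -/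
theorem gameZ_cv (A : ℝ)
    (next : ∀ Q : Finset Pt, (∀ q ∈ Q, IsBlocker q → -q.1 ≤ A) → (∀ q ∈ Q, IsBlocker q → q.2.1 ≠ 0) →
      HasPedigree Q) :
    ∀ (n : ℕ) (P : Finset Pt), (∀ p ∈ P, IsBlocker p → -p.1 ≤ A) →
      (∀ p ∈ P, IsBlocker p → p.2.1 = 0 → p.2.2 ≠ 0) →
      (∃ cp cm : ℝ, 0 < cp ∧ 0 < cm ∧ (∀ p ∈ P, IsBlocker p → p.2.1 = 0 → 0 < p.2.2 → cp ≤ p.2.2) ∧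
        (∀ p ∈ P, IsBlocker p → p.2.1 = 0 → p.2.2 < 0 → cm ≤ -p.2.2) ∧ ⌊A / cp⌋₊ + ⌊A / cm⌋₊ ≤ n) →
      HasPedigree P := by
  intro n
  induction n with
  | zero =>
    intro P hA hNA ⟨cp, cm, hcp, hcm, hCp, hCm, hμ⟩
    apply next P hA
    intro q hq hb h20
    have h0 : ⌊A / cp⌋₊ = 0 ∧ ⌊A / cm⌋₊ = 0 := by omega
    rcases lt_trichotomy q.2.2 0 with hneg | h0' | hpos
    · have h1 := hCm q hq hb h20 hneg
      have h2 := abs3_le_of_isBlocker_cv hb; rw [abs_of_neg hneg] at h2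
      have h3 := hA q hq hb
      have : A / cm < 1 := Nat.floor_eq_zero.1 h0.2
      rw [div_lt_one hcm] at this; linarith
    · exact hNA q hq hb h20 h0'
    · have h1 := hCp q hq hb h20 hpos
      have h2 := abs3_le_of_isBlocker_cv hb; rw [abs_of_pos hpos] at h2
      have h3 := hA q hq hb
      have : A / cp < 1 := Nat.floor_eq_zero.1 h0.1
      rw [div_lt_one hcp] at this; linarith
  | succ n ih =>
    intro P hA hNA ⟨cp, cm, hcp, hcm, hCp, hCm, hμ⟩
    by_cases hB : (P.filter fun p => IsBlocker p ∧ p.2.1 = 0).Nonempty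
    swap
    · apply next P hA; intro q hq hb h20; exact hB ⟨q, Finset.mem_filter.2 ⟨hq, hb, h20⟩⟩
    obtain ⟨m, hm, hmin⟩ := (P.filter fun p => IsBlocker p ∧ p.2.1 = 0).exists_min_image (fun p => |p.2.2|) hB
    obtain ⟨hmP, hmb, hm20⟩ := Finset.mem_filter.1 hm
    have hmin' : ∀ p ∈ P, IsBlocker p → p.2.1 = 0 → |m.2.2| ≤ |p.2.2| :=
      fun p hp hb h20 => hmin p (Finset.mem_filter.2 ⟨hp, hb, h20⟩)
    set x := |m.2.2| with hx
    have hx0 : 0 < x := abs_pos.2 (hNA m hmP hmb hm20)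
    have hxA : x ≤ A := le_trans (abs3_le_of_isBlocker_cv hmb) (hA m hmP hmb)
    obtain ⟨T, hT1, hT2, hTS⟩ := exists_Ioo_not_mem (x / 2) x (by linarith)
      ((P.image fun p => p.2.2) ∪ (P.image fun p => p.2.2 / 2) ∪ (P.image fun p => -p.2.2) ∪ (P.image fun p => -p.2.2 / 2))
    have hT0 : 0 < T := by linarith
    simp only [Finset.mem_union, Finset.mem_image, not_or, not_exists, not_and] at hTS
    obtain ⟨⟨⟨hS1, hS2⟩, hS3⟩, hS4⟩ := hTS
    rcases lt_or_gt_of_ne (hNA m hmP hmb hm20) with hmneg | hmpos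
    · -- least member on the NEGATIVE side: cut (−e₃, T)
      have hxm : x = -m.2.2 := by rw [hx, abs_of_neg hmneg]
      refine HasPedigree.cut (0,0,-1) T (by simp [dirs]) hT0 (fun p hp h => hS3 p hp (by simpa using h)) ?_
      apply ih
      · intro q hq hb
        rcases mem_pcut hq with ⟨hqP, -⟩ | ⟨p, hp, hpc, rfl⟩
        · exact hA q hqP hb
        · simp only [prefl_00m1] at hb ⊢
          simp only [pdot_00m1] at hpc
          exact hA p hp (blocker_of_image_me3_cv hT0 hpc hb)
      · intro q hq hb h20
        rcases mem_pcut hq with ⟨hqP, -⟩ | ⟨p, hp, hpc, rfl⟩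
        · exact hNA q hqP hb h20
        · simp only [prefl_00m1] at hb h20 ⊢
          intro h0; exact hS4 p hp (by linarith)
      · refine ⟨cp, 2 * x, hcp, by linarith, ?_, ?_, ?_⟩
        · intro q hq hb h20 hpos
          rcases mem_pcut hq with ⟨hqP, -⟩ | ⟨p, hp, hpc, rfl⟩
          · exact hCp q hqP hb h20 hpos
          · exfalso
            simp only [prefl_00m1] at hb hpos
            simp only [pdot_00m1] at hpc
            linarith
        · intro q hq hb h20 hneg
          rcases mem_pcut hq with ⟨hqP, hqc⟩ | ⟨p, hp, hpc, rfl⟩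
          · exfalso
            simp only [pdot_00m1] at hqc
            have := hmin' q hqP hb h20
            rw [abs_of_neg hneg] at this
            linarith
          · simp only [prefl_00m1] at hb hneg h20 ⊢
            simp only [pdot_00m1] at hpc
            have hpb := blocker_of_image_me3_cv hT0 hpc hb
            have := hmin' p hp hpb h20
            have hp3 : x ≤ p.2.2 := by
              rcases le_or_gt p.2.2 0 with h | h
              · rw [abs_of_nonpos h] at this; linarith
              · rwa [abs_of_pos h] at this
            show 2 * x ≤ -(-2 * T - p.2.2)
            linarith
        · have := floor_half_lt_cv hx0 hxA
          have hle : ⌊A / x⌋₊ ≤ ⌊A / cm⌋₊ := by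
            apply Nat.floor_le_floor
            have hcmx : cm ≤ x := by rw [hxm]; exact hCm m hmP hmb hm20 hmneg
            exact div_le_div_of_nonneg_left (by linarith) hcm hcmx
          omega
    · -- least member on the POSITIVE side: cut (e₃, T)
      have hxm : x = m.2.2 := by rw [hx, abs_of_pos hmpos]
      refine HasPedigree.cut (0,0,1) T (by simp [dirs]) hT0 (fun p hp h => hS1 p hp (by simpa using h)) ?_
      apply ih
      · intro q hq hb
        rcases mem_pcut hq with ⟨hqP, -⟩ | ⟨p, hp, hpc, rfl⟩
        · exact hA q hqP hb
        · simp only [prefl_001] at hb ⊢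
          simp only [pdot_001] at hpc
          exact hA p hp (blocker_of_image_e3_cv hT0 hpc hb)
      · intro q hq hb h20
        rcases mem_pcut hq with ⟨hqP, -⟩ | ⟨p, hp, hpc, rfl⟩
        · exact hNA q hqP hb h20
        · simp only [prefl_001] at hb h20 ⊢
          intro h0; exact hS2 p hp (by linarith)
      · refine ⟨2 * x, cm, by linarith, hcm, ?_, ?_, ?_⟩
        · intro q hq hb h20 hpos
          rcases mem_pcut hq with ⟨hqP, hqc⟩ | ⟨p, hp, hpc, rfl⟩
          · exfalso
            simp only [pdot_001] at hqc
            have := hmin' q hqP hb h20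
            rw [abs_of_pos hpos] at this
            linarith
          · simp only [prefl_001] at hb hpos h20 ⊢
            simp only [pdot_001] at hpc
            have hpb := blocker_of_image_e3_cv hT0 hpc hb
            have := hmin' p hp hpb h20
            have hp3 : p.2.2 ≤ -x := by
              rcases le_or_gt 0 p.2.2 with h | h
              · rw [abs_of_nonneg h] at this; linarith
              · rw [abs_of_neg h] at this; linarith
            show 2 * x ≤ 2 * T - p.2.2
            linarith
        · intro q hq hb h20 hneg
          rcases mem_pcut hq with ⟨hqP, -⟩ | ⟨p, hp, hpc, rfl⟩
          · exact hCm q hqP hb h20 hneg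
          · exfalso
            simp only [prefl_001] at hb hneg
            simp only [pdot_001] at hpc
            linarith
        · have := floor_half_lt_cv hx0 hxA
          have hle : ⌊A / x⌋₊ ≤ ⌊A / cp⌋₊ := by
            apply Nat.floor_le_floor
            have hcpx : cp ≤ x := by rw [hxm]; exact hCp m hmP hmb hm20 hmpos
            exact div_le_div_of_nonneg_left (by linarith) hcp hcpx
          omega

/-! ### PHASE 1, step (i), and the assembly -/

/-- Step (i): one cut `(−e₁+e₂, t₀)` with `t₀` tiny and generic removes every AXIS blocker
(`p₂ = p₃ = 0`, `p₁ < 0`) and creates none. [folklore] -/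
theorem noAxis_after_diag_cv (P : Finset Pt) :
    ∃ t₀ : ℝ, 0 < t₀ ∧ (∀ p ∈ P, pdot (-1,1,0) p ≠ t₀) ∧
      ∀ q ∈ pcut (-1,1,0) t₀ P, IsBlocker q → q.2.1 = 0 → q.2.2 ≠ 0 := by
  obtain ⟨t₀, ht0, htin, htS⟩ := exists_tiny P (fun p => p.2.1 - p.1) (P.image fun p => -p.1)
  refine ⟨t₀, ht0, fun p hp => by rw [pdot_m110]; exact off_mirror_of_tiny ht0 htin p hp, ?_⟩
  intro q hq hb h20 h30
  rcases mem_pcut hq with ⟨hqP, hqc⟩ | ⟨p, hp, hpc, rfl⟩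
  · simp only [pdot_m110] at hqc
    have hle : q.2.1 - q.1 ≤ 0 := not_lt.1 fun h => absurd (htin q hqP h) (by linarith)
    have hq1 : q.1 ≤ 0 := by have := hb.2.1; rw [h20] at this; simpa using this
    have hq0 : q.1 ≠ 0 := by
      intro h; apply hb.1; ext <;> simp [h, h20, h30]
    have : q.1 < 0 := lt_of_le_of_ne hq1 hq0
    linarith
  · simp only [prefl_m110] at h20 h30 hb
    apply htS
    exact Finset.mem_image.2 ⟨p, hp, by linarith⟩

/-- **THE COVERING THEOREM** (Disproof §G.3): every finite configuration of `ℝ³` has a mirror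
pedigree — finitely many admissible cuts in the cubic directions after which `0` is the strict
`v₁`-minimum. Assembly: step (i), game (Z), game (M), Phase 2. [folklore] -/
theorem covering_cv (P : Finset Pt) : HasPedigree P := by
  -- step (i)
  obtain ⟨t₀, ht0, hoff, hNA⟩ := noAxis_after_diag_cv P
  refine HasPedigree.cut (-1,1,0) t₀ (by simp [dirs]) ht0 hoff ?_
  set P₁ := pcut (-1,1,0) t₀ P
  -- level bound
  obtain ⟨A, hA⟩ := (P₁.image fun p : Pt => -p.1).bddAbove
  have hA' : ∀ p ∈ P₁, IsBlocker p → -p.1 ≤ A := fun p hp _ => hA (Finset.mem_image.2 ⟨p, hp, rfl⟩)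
  -- game (M) followed by Phase 2 (the companion file's anchor) as the callback of game (Z)
  have next : ∀ Q : Finset Pt, (∀ q ∈ Q, IsBlocker q → -q.1 ≤ A) →
      (∀ q ∈ Q, IsBlocker q → q.2.1 ≠ 0) → HasPedigree Q :=
    fun Q _ hZQ => hasPedigree_of_noPlaneBlocker_cv Q hZQ
  obtain ⟨cp, hcp, hCp⟩ := exists_pos_le_all P₁ fun q => q.2.2
  obtain ⟨cm, hcm, hCm⟩ := exists_pos_le_all P₁ fun q => -q.2.2
  exact gameZ_cv A next _ P₁ hA' hNA ⟨cp, cm, hcp, hcm, fun q hq _ _ h => hCp q hq h,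
    fun q hq _ _ h => hCm q hq (by linarith), le_rfl⟩

end Cover

/-- **The covering theorem** for the line `only-interaction-breaks-moebius` (stub `covering_all`):
every finite configuration `P ⊂ ℝ³` (moving point translated to `0`) admits a MIRROR PEDIGREE —
finitely many admissible cuts in the 18 signed cubic mirror directions after which `0` is the strict
extreme point in a coordinate direction (`Cover.HasPedigree P` of `PedigreeCuts.lean`). [folklore] -/
theorem covering_all :
    ∀ P : Finset (ℝ × ℝ × ℝ),
      Summit.CriticalPhenomena.Ising3DConformalLimit.MoebiusLimitExistsNegative.Pedigree.Cover.HasPedigree P :=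
  fun P => Cover.covering_cv P

end Summit.CriticalPhenomena.Ising3DConformalLimit.MoebiusLimitExistsOnlyInteraction

end
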